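import Literature.AlgebraicGeometry.Motives.CartierDivisorCocycle
import HarnessLib

/-!
# Scaling sections of `ι^*𝒪_X(D)` by functions; the ratio of two trivialisations

`Motives/CartierDivisorCocycle` records global sections (`CartierDivisor.SectionAlong`) and
trivialisations (`CartierDivisor.Trivialization`) of the line bundle `ι^*𝒪_X(D)` along a morphism
`ι : X' → X` in chart form: coordinates `σ_i ∈ Γ(ι⁻¹U_i, 𝒪_{X'})` with `σ_i = ι^*(g_ij) σ_j`. This
file adds the `Γ(X', 𝒪_{X'})`-module operations used in the deformation arguments of
Görtz–Wedhorn II, Lemma 24.72 (where lifted trivialising sections are adjusted by global units,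
"by (*) the sections `gᵢ^*(σⱼ)` [...] can be lifted"):

* `SectionAlong.scale a s` — the section `a · s`, coordinates `a|_{ι⁻¹U_i} σ_i`, for a global
  function `a ∈ Γ(X', 𝒪_{X'})` (the `Γ(X', 𝒪)`-module structure of `Γ(X', ι^*𝒪_X(D))`), with
  `scale_one`, `scale_mul`, compatibility with pullback `SectionAlong.comp`;
  `Trivialization.scale u τ` for a global unit `u`.
* `Trivialization.exists_unique_scale_eq` — **two trivialisations differ by a unique global unit**:
  for trivialisations `τ`, `τ'` of `ι^*𝒪_X(D)` there is a unique `u ∈ Γ(X', 𝒪_{X'})^×` with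
  `τ' = u · τ` (the local ratios `σ'_i / σ_i` agree on overlaps because the cocycle cancels, and
  glue by the sheaf property; Görtz–Wedhorn I, (11.6): `Isom(𝒪, 𝓛)` is a `GL₁(𝒪) = 𝒪^×`-torsor,
  the action being simply transitive on global sections when non-empty).

All statements are proved; no named facts. Related notions in this tree: `SectionAlong`,
`Trivialization`, `TrivialAlong` (`Motives/CartierDivisorCocycle`). Mathlib searched (pin):
`TopCat.Sheaf.existsUnique_gluing'`, `TopCat.Sheaf.eq_of_locally_eq'`,
`RingedSpace.isUnit_of_isUnit_germ`, `Scheme.Hom.appLE_map`, `Scheme.Hom.map_appLE` (used).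

## References

* U. Görtz, T. Wedhorn, *Algebraic Geometry I: Schemes*, 2nd ed. (2020),
  doi:10.1007/978-3-658-30733-2: (11.5)–(11.6), torsors and `GL_n(𝒪_X)`, pp. 365–369 (read via
  the held copy). [GortzWedhorn2020]
* U. Görtz, T. Wedhorn, *Algebraic Geometry II: Cohomology of Schemes* (2023),
  doi:10.1007/978-3-658-43031-3: Lemma 24.72, proof, pp. 548–549. [GortzWedhorn2023]
-/

universe u

open CategoryTheory AlgebraicGeometry TopologicalSpace Opposite

noncomputable section

namespace Literature.AlgebraicGeometry.Motives

namespace CartierDivisor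

open RatFn

variable {X X' X'' : Scheme.{u}} [IsIntegral X] {D : CartierDivisor X} {ι : X' ⟶ X}

/-- Restriction of a global function of `X'` to an open. [folklore] -/
abbrev resTo (X' : Scheme.{u}) (V : X'.Opens) : Γ(X', ⊤) →+* Γ(X', V) :=
  (X'.presheaf.map (homOfLE le_top).op).hom

omit [IsIntegral X] in
/-- Restricting a restricted global function. [folklore] -/
theorem map_resTo {V W : X'.Opens} (e : W ≤ V) (a : Γ(X', ⊤)) :
    X'.presheaf.map (homOfLE e).op (resTo X' V a) = resTo X' W a :=
  res_res _ _ a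

namespace SectionAlong

/-- **Scaling a section by a global function**: `(a · s)_i = a|_{ι⁻¹U_i} σ_i` (the
`Γ(X', 𝒪_{X'})`-module structure of `Γ(X', ι^*𝒪_X(D))` in coordinates). [folklore] -/
def scale (a : Γ(X', ⊤)) (s : D.SectionAlong ι) : D.SectionAlong ι where
  σ i := resTo X' _ a * s.σ i
  cocycle i j := by
    rw [map_mul, map_mul, map_resTo, map_resTo, s.cocycle i j]
    ring

/-- The coordinates of a scaled section. [folklore] -/
@[simp]
theorem scale_σ (a : Γ(X', ⊤)) (s : D.SectionAlong ι) (i : D.ι) :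
    (s.scale a).σ i = resTo X' _ a * s.σ i := rfl

/-- `1 · s = s`. [folklore] -/
@[simp]
theorem scale_one (s : D.SectionAlong ι) : s.scale 1 = s := by
  ext i; simp

/-- `a · (b · s) = (a b) · s`. [folklore] -/
theorem scale_scale (a b : Γ(X', ⊤)) (s : D.SectionAlong ι) :
    (s.scale b).scale a = s.scale (a * b) := by
  ext i; simp [mul_assoc]

omit [IsIntegral X] in
/-- `appLE` between the top opens is `appTop`. [folklore] -/
theorem appLE_top_top (φ : X'' ⟶ X') (e : (⊤ : X''.Opens) ≤ φ ⁻¹ᵁ ⊤) :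
    φ.appLE ⊤ ⊤ e = φ.appTop := by
  rw [Scheme.Hom.appTop, Scheme.Hom.app_eq_appLE]
  rfl

omit [IsIntegral X] in
/-- Restricting `φ^*(a)` to `V` is `appLE ⊤ V`. [folklore] -/
theorem resTo_appTop (φ : X'' ⟶ X') (V : X''.Opens) (a : Γ(X', ⊤)) :
    resTo X'' V (φ.appTop a) = φ.appLE ⊤ V (fun _ _ => trivial) a := by
  change (φ.appTop ≫ X''.presheaf.map (homOfLE le_top).op) a = _
  rw [← appLE_top_top φ le_top, Scheme.Hom.appLE_map]

/-- Scaling commutes with pullback: `φ^*(a · s) = φ^*(a) · φ^*(s)`. [folklore] -/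
theorem scale_comp (a : Γ(X', ⊤)) (s : D.SectionAlong ι) (φ : X'' ⟶ X') :
    (s.scale a).comp φ = (s.comp φ).scale (φ.appTop a) := by
  ext i
  simp only [comp_σ, scale_σ, map_mul]
  congr 1
  rw [resTo_appTop]
  change (X'.presheaf.map (homOfLE le_top).op ≫ φ.appLE (ι ⁻¹ᵁ D.U i) ((φ ≫ ι) ⁻¹ᵁ D.U i)
    le_rfl) a = _
  rw [Scheme.Hom.map_appLE]

end SectionAlong

namespace Trivialization

/-- **Scaling a trivialisation by a global unit.** [folklore] -/
def scale (u : Γ(X', ⊤)ˣ) (τ : D.Trivialization ι) : D.Trivialization ι where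
  toSectionAlong := τ.toSectionAlong.scale u
  isUnit i := ((u.isUnit.map _).mul (τ.isUnit i))

/-- The underlying section of a scaled trivialisation. [folklore] -/
@[simp]
theorem scale_toSectionAlong (u : Γ(X', ⊤)ˣ) (τ : D.Trivialization ι) :
    (τ.scale u).toSectionAlong = τ.toSectionAlong.scale u := rfl

/-- The coordinates of a scaled trivialisation. [folklore] -/
@[simp]
theorem scale_σ (u : Γ(X', ⊤)ˣ) (τ : D.Trivialization ι) (i : D.ι) :
    (τ.scale u).σ i = resTo X' _ (u : Γ(X', ⊤)) * τ.σ i := rfl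

/-- The charts `ι⁻¹U_i` cover `X'`. [folklore] -/
theorem iSup_preimage_U_eq_top (D : CartierDivisor X) (ι : X' ⟶ X) :
    (⊤ : X'.Opens) ≤ ⨆ i, ι ⁻¹ᵁ D.U i := fun x _ => by
  obtain ⟨i, hi⟩ := D.covers (ι x)
  exact Opens.mem_iSup.2 ⟨i, hi⟩

/-- **Two trivialisations of `ι^*𝒪_X(D)` differ by a unique global unit** `u ∈ Γ(X', 𝒪_{X'})^×`,
`τ' = u · τ`: the ratios `σ'_i / σ_i ∈ Γ(ι⁻¹U_i, 𝒪^×)` agree on overlaps (the cocycle `ι^*(g_ij)`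
cancels) and glue (Görtz–Wedhorn I, (11.6): the trivialisations of a line bundle form an
`𝒪^×`-torsor). [folklore] -/
theorem exists_unique_scale_eq (τ τ' : D.Trivialization ι) :
    ∃! u : Γ(X', ⊤)ˣ, τ' = τ.scale u := by
  -- the local ratios `r i = σ'_i / σ_i`
  have hr : ∀ i, ∃ r : Γ(X', ι ⁻¹ᵁ D.U i), τ'.σ i = r * τ.σ i := fun i => by
    obtain ⟨v, hv⟩ := τ.isUnit i
    exact ⟨τ'.σ i * ↑v⁻¹, by rw [mul_assoc, ← hv, Units.inv_mul, mul_one]⟩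
  choose r hr using hr
  -- they are compatible on overlaps
  have hcompat : TopCat.Presheaf.IsCompatible X'.presheaf (fun i => ι ⁻¹ᵁ D.U i) r := by
    intro i j
    have hi := congrArg (X'.presheaf.map (homOfLE (inf_le_left :
      ι ⁻¹ᵁ D.U i ⊓ ι ⁻¹ᵁ D.U j ≤ _)).op) (hr i)
    have hj := congrArg (X'.presheaf.map (homOfLE (inf_le_right :
      ι ⁻¹ᵁ D.U i ⊓ ι ⁻¹ᵁ D.U j ≤ _)).op) (hr j)
    rw [map_mul] at hi hj
    rw [τ'.cocycle i j, τ.cocycle i j, hj] at hi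
    -- `g (r_j σ_j) = r_i (g σ_j)` with `g σ_j` a unit
    have hu : IsUnit (ι.appLE (D.U i ⊓ D.U j) (ι ⁻¹ᵁ D.U i ⊓ ι ⁻¹ᵁ D.U j)
        (D.preimage_inf_le ι i j) (D.transFun i j) *
        X'.presheaf.map (homOfLE inf_le_right).op (τ.σ j)) :=
      ((D.isUnit_transFun i j).map _).mul ((τ.isUnit j).map _)
    have h2 : (ι.appLE (D.U i ⊓ D.U j) (ι ⁻¹ᵁ D.U i ⊓ ι ⁻¹ᵁ D.U j)
        (D.preimage_inf_le ι i j) (D.transFun i j) *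
        X'.presheaf.map (homOfLE inf_le_right).op (τ.σ j)) *
        X'.presheaf.map (homOfLE inf_le_right).op (r j) =
      (ι.appLE (D.U i ⊓ D.U j) (ι ⁻¹ᵁ D.U i ⊓ ι ⁻¹ᵁ D.U j)
        (D.preimage_inf_le ι i j) (D.transFun i j) *
        X'.presheaf.map (homOfLE inf_le_right).op (τ.σ j)) *
        X'.presheaf.map (homOfLE inf_le_left).op (r i) := by
      rw [mul_comm _ (X'.presheaf.map (homOfLE inf_le_left).op (r i)), ← hi]
      ring
    exact (hu.mul_right_inj.1 h2).symm
  -- glue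
  obtain ⟨u, hu, huniq⟩ : ∃! u : Γ(X', ⊤), ∀ i, X'.presheaf.map (homOfLE le_top).op u = r i :=
    X'.sheaf.existsUnique_gluing' (fun i => ι ⁻¹ᵁ D.U i) ⊤ (fun i => homOfLE le_top)
      (iSup_preimage_U_eq_top D ι) r hcompat
  -- `u` is a unit: locally it is the unit `r i`
  have hru : ∀ i, IsUnit (r i) := fun i => by
    obtain ⟨v', hv'⟩ := τ'.isUnit i
    obtain ⟨v, hv⟩ := τ.isUnit i
    have h1 : (v' : Γ(X', ι ⁻¹ᵁ D.U i)) = r i * v := by rw [hv', hv]; exact hr i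
    have h3 : r i = v' * ↑v⁻¹ := by rw [h1, mul_assoc, Units.mul_inv, mul_one]
    rw [h3]
    exact v'.isUnit.mul (v⁻¹).isUnit
  have huu : IsUnit u := by
    refine RingedSpace.isUnit_of_isUnit_germ (X := X'.toLocallyRingedSpace.toRingedSpace) ⊤ u
      fun x _ => ?_
    obtain ⟨i, hi⟩ := D.covers (ι x)
    have hgerm : X'.presheaf.germ ⊤ x trivial u =
        X'.presheaf.germ (ι ⁻¹ᵁ D.U i) x hi (r i) := by
      rw [← hu i]
      exact (TopCat.Presheaf.germ_res_apply X'.presheaf (homOfLE le_top) x hi u).symm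
    rw [hgerm]
    exact (hru i).map _
  refine ExistsUnique.intro huu.unit ?_ ?_
  · -- `τ' = u · τ`
    cases τ' with
    | mk s' hs' =>
      have : s' = τ.toSectionAlong.scale (huu.unit : Γ(X', ⊤)) := by
        ext i
        rw [SectionAlong.scale_σ, IsUnit.unit_spec]
        change s'.σ i = X'.presheaf.map (homOfLE le_top).op u * τ.σ i
        rw [hu i]
        exact hr i
      cases this
      rfl
  · -- uniqueness
    intro w hw
    ext
    apply huniq
    intro i
    have h1 := congrArg (fun τ'' : D.Trivialization ι => τ''.σ i) hw
    simp only [scale_σ] at h1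
    -- `r i σ_i = w| σ_i` with `σ_i` a unit
    have h2 : X'.presheaf.map (homOfLE le_top).op (w : Γ(X', ⊤)) * τ.σ i = r i * τ.σ i := by
      rw [← hr i]; exact h1.symm
    exact (τ.isUnit i).mul_left_inj.1 h2

end Trivialization

end CartierDivisor

end Literature.AlgebraicGeometry.Motives

end
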